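import Literature.Computability.Cryptography.QuantumTuringMachineUnidirectional
import Literature.Computability.QuantumComplexity.QTMCircuitGadgets
import HarnessLib

/-!
# The circuit simulating a quantum Turing machine, I: wires, the encoding of configurations, and the classical sub-programs

Second file of the formalisation of the simulation of quantum Turing machines by quantum
circuits (Yao 1993; Nishimura–Ozawa 2002, Thm. 4.3) in Bernstein–Vazirani's positioned model
(`Cryptography/QuantumTuringMachinePositioned.lean`), for unidirectional machines
(`Cryptography/QuantumTuringMachineUnidirectional.lean`; Bernstein–Vazirani 1997, Def. 3.14 and
Lemma 5.5). This file is purely classical: it fixes the wires of the circuit for inputs of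
length `n` and `T` simulated steps, the computational-basis label `enc x T c` representing a
positioned configuration `c`, and the reversible sub-programs of one simulated step together
with their semantics on encoded configurations. The single quantum gate of a step (the local
matrix `QTM.localMat` on the state register and the register of the scanned symbol) and the
linear-algebraic bookkeeping are the subject of the sequel.

## Layout (after Nishimura–Ozawa 2002, proof of Thm. 4.3, with unary codes)

Wires `YW M n W` (`W = 2T + n + 1` cells, cell `j` standing for the tape cell `j - T`, so that the
cells `-T, …, T + n` reachable or written in `T` steps from an input of length `n` are present,
`QTM.support_pstateAt_inWindow`):
* `inp i` (`i < n`) — the input wires (never modified);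
* `st q` (`q ∈ Q`) — the **state register**, one-hot;
* `reg τ` (`τ ∈ Σ`) — the **register of the scanned symbol**, one-hot while the local unitary
  acts and `0` otherwise;
* `dir` — the direction bit of a move (computed and uncomputed within the step);
* `ans` — the answer wire;
* `cell j τ` — the **tape cells**, cell `j` one-hot over `Σ`;
* `head j` — the **head track**, one-hot at the cell scanned by the head (Nishimura–Ozawa's two
  extra bits `s_i` per cell, here one bit).

## Programs and their semantics on `enc`

* `fetch` — for every cell `j`, Fredkin gates controlled by `head j` exchanging `cell j` with
  `reg`: the scanned symbol moves into the register (`clEval_fetch_enc`) and, applied again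
  after the local unitary has acted on `(st, reg)`, the written symbol moves back
  (`clEval_fetch_applied`);
* `move D` — the direction bit `[D q' = R]` is the parity of the state wires of the right-moving
  states (one-hot register), the head track is rotated right under `dir` and left under `¬dir`,
  and `dir` is uncomputed: the head marker moves as the new state prescribes
  (`clEval_move_written`; Bernstein–Vazirani 1997, Def. 3.14);
* `initOps` — blank codes, the input symbols (from the input wires), the start state and the
  head marker at cell `T`: `clEval_initOps_inputAssign` gives `enc x T (pinit x)`;
* `outputOps` — the answer `[q = accept]` is copied to `ans` and swapped onto the wire that is
  wire `0` of the circuit (`inp 0`, or `st q₀` when `n = 0`).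
`enc` is injective on the configurations of the window (`enc_injective_of_inWindow`).

## References

* A. C.-C. Yao, *Quantum circuit complexity*, Proc. 34th FOCS (1993) 352–361 [YaoFOCS1993].
* H. Nishimura, M. Ozawa, *Computational complexity of uniform quantum circuit families and
  quantum Turing machines*, Theoret. Comput. Sci. 276 (2002) 147–181 = arXiv:quant-ph/9906095
  [NishimuraOzawa2002]: Thm. 4.3 and its proof (cells `j - t`, `j ∈ [0, 2t]`; gates `G₁`, `G₂`).
* E. Bernstein, U. Vazirani, *Quantum complexity theory*, SIAM J. Comput. 26 (1997) 1411–1473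
  [BernsteinVaziraniSICOMP1997]: Def. 3.2, Def. 3.14, Lemma 5.5.
* M. A. Nielsen, I. L. Chuang, *Quantum Computation and Quantum Information*, CUP 2010, §3.2.5
  (reversible classical computation) [NielsenChuang2010].
-/

noncomputable section

namespace Literature.Computability.QuantumComplexity

namespace YaoSim

open Cryptography QTM Function Turing

/-! ### Wires -/

/-- The wires of the circuit simulating `M` on inputs of length `n` with a window of `W` cells
(unary codes for states, symbols and the head position; Nishimura–Ozawa 2002, proof of
Thm. 4.3, "cell `P`" = `st`, "cell `i`" = `cell (i + T)` with its head bits = `head (i + T)`). [cite: NishimuraOzawa2002, Thm. 4.3 (proof)] -/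
inductive YW (M : QTM) (n W : ℕ) : Type
  /-- input wire `i` -/
  | inp (i : Fin n)
  /-- state register, the wire of state `q` -/
  | st (q : M.Λ)
  /-- register of the scanned symbol, the wire of symbol `τ` -/
  | reg (τ : M.Γ)
  /-- direction bit -/
  | dir
  /-- answer wire -/
  | ans
  /-- tape cell `j` of the window, the wire of symbol `τ` -/
  | cell (j : Fin W) (τ : M.Γ)
  /-- head track, cell `j` -/
  | head (j : Fin W)
  deriving DecidableEq

variable (M : QTM)

/-- The number of cells of the window for `T` steps on inputs of length `n`: the cells
`-T, …, T + n` (Nishimura–Ozawa's `2t + 1` cells and the `n` input cells to the right of the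
start cell). [cite: NishimuraOzawa2002, Thm. 4.3 (proof)] -/
abbrev Wd (n T : ℕ) : ℕ := 2 * T + n + 1

/-- The tape symbols listed in the order of their numbering `Fintype.equivFin`. [folklore] -/
def symList : List M.Γ :=
  (List.finRange (Fintype.card M.Γ)).map (Fintype.equivFin M.Γ).symm

/-- The control states listed in the order of their numbering. [folklore] -/
def stList : List M.Λ :=
  (List.finRange (Fintype.card M.Λ)).map (Fintype.equivFin M.Λ).symm

variable {M}

/-- Every symbol is listed. [folklore] -/
theorem mem_symList (τ : M.Γ) : τ ∈ symList M :=
  List.mem_map.2 ⟨Fintype.equivFin M.Γ τ, List.mem_finRange _, by simp⟩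

/-- Every state is listed. [folklore] -/
theorem mem_stList (q : M.Λ) : q ∈ stList M :=
  List.mem_map.2 ⟨Fintype.equivFin M.Λ q, List.mem_finRange _, by simp⟩

/-- The symbol list has no duplicates. [folklore] -/
theorem nodup_symList : (symList M).Nodup :=
  (List.nodup_finRange _).map (Fintype.equivFin M.Γ).symm.injective

/-- The state list has no duplicates. [folklore] -/
theorem nodup_stList : (stList M).Nodup :=
  (List.nodup_finRange _).map (Fintype.equivFin M.Λ).symm.injective

/-- The `k`-th listed symbol is the symbol numbered `k`. [folklore] -/
theorem getElem?_symList (k : ℕ) :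
    (symList M)[k]? = if h : k < Fintype.card M.Γ then some ((Fintype.equivFin M.Γ).symm ⟨k, h⟩)
      else none := by
  unfold symList
  split_ifs with h
  · rw [List.getElem?_map, List.getElem?_eq_getElem (by simpa using h)]
    simp
  · rw [List.getElem?_eq_none (by simpa using Nat.le_of_not_lt h)]

variable {n W : ℕ}

/-- The wires of the symbol register, in symbol order. [folklore] -/
def regL (M : QTM) (n W : ℕ) : List (YW M n W) := (symList M).map YW.reg

/-- The wires of tape cell `j`, in symbol order. [folklore] -/
def cellL (j : Fin W) : List (YW M n W) := (symList M).map (YW.cell j)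

/-- The head track as a function on `ℕ` (junk value `ans` beyond the window). [folklore] -/
def hTrack (M : QTM) (n W : ℕ) (j : ℕ) : YW M n W :=
  if h : j < W then YW.head ⟨j, h⟩ else YW.ans

/-- On the window the head track is the head wire. [folklore] -/
theorem hTrack_of_lt {j : ℕ} (h : j < W) : hTrack M n W j = YW.head ⟨j, h⟩ := dif_pos h

/-- The head track is injective on the window. [folklore] -/
theorem hTrack_inj (i : ℕ) (hi : i < W) (j : ℕ) (hj : j < W) (h : hTrack M n W i = hTrack M n W j) :
    i = j := by
  rw [hTrack_of_lt hi, hTrack_of_lt hj] at h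
  simpa [Fin.ext_iff] using h

/-- The direction wire is off the head track. [folklore] -/
theorem dir_ne_hTrack (j : ℕ) (hj : j < W) : (YW.dir : YW M n W) ≠ hTrack M n W j := by
  rw [hTrack_of_lt hj]; simp

/-! ### The encoding of positioned configurations -/

/-- **The basis label of a positioned configuration** on input `x` with `T` simulated steps:
input wires hold `x`, the state register the one-hot code of the state, the symbol register,
the direction bit and the answer wire are clear, cell `j` holds the one-hot code of the tape
cell `j - T`, and the head track marks cell `ξ + T` (Nishimura–Ozawa 2002, proof of Thm. 4.3:
`|q; T(-t)0̄; ⋯; T(i)1̄; ⋯; T(t)0̄⟩`). [cite: NishimuraOzawa2002, Thm. 4.3 (proof)] -/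
def enc (x : List Bool) (T : ℕ) (c : M.PCfg) : YW M x.length (Wd x.length T) → Bool
  | .inp i => x[i]
  | .st q => decide (c.1.q = q)
  | .reg _ => false
  | .dir => false
  | .ans => false
  | .cell j τ => decide (PCfg.cells c ((j : ℤ) - T) = τ)
  | .head j => decide (c.2 + T = j)

/-- The label after `fetch`: the scanned symbol sits in the register and the scanned cell is
clear. [cite: NishimuraOzawa2002, Thm. 4.3 (proof)] -/
def fetched (x : List Bool) (T : ℕ) (c : M.PCfg) : YW M x.length (Wd x.length T) → Bool
  | .reg τ => decide (c.1.tape.head = τ)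
  | .cell j τ => if c.2 + T = j then false else decide (PCfg.cells c ((j : ℤ) - T) = τ)
  | i => enc x T c i

/-- The label after the local unitary has produced (new state `q'`, written symbol `b`) in the
registers: state register `q'`, symbol register `b`, scanned cell still clear. [cite: NishimuraOzawa2002, Thm. 4.3 (proof)] -/
def applied (x : List Bool) (T : ℕ) (c : M.PCfg) (q' : M.Λ) (b : M.Γ) :
    YW M x.length (Wd x.length T) → Bool
  | .st q => decide (q' = q)
  | .reg τ => decide (b = τ)
  | i => fetched x T c i

/-- The label after writing back: state `q'`, the scanned cell holds `b`, register clear, head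
marker still at the old position. [cite: NishimuraOzawa2002, Thm. 4.3 (proof)] -/
def written (x : List Bool) (T : ℕ) (c : M.PCfg) (q' : M.Λ) (b : M.Γ) :
    YW M x.length (Wd x.length T) → Bool
  | .st q => decide (q' = q)
  | .reg _ => false
  | .cell j τ => if c.2 + T = j then decide (b = τ) else decide (PCfg.cells c ((j : ℤ) - T) = τ)
  | i => enc x T c i

section Semantics

variable {x : List Bool} {T s : ℕ} {c : M.PCfg}

/-- The head cell index of a configuration of the window. [folklore] -/
theorem headIdx_lt (h : PCfg.InWindow x.length s c) (hs : s ≤ T) :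
    (c.2 + T).toNat < Wd x.length T := by
  have := h.1; have := h.2.1
  show (c.2 + T).toNat < 2 * T + x.length + 1
  omega

/-- The head cell index, as an integer. [folklore] -/
theorem headIdx_cast (h : PCfg.InWindow x.length s c) (hs : s ≤ T) :
    (((c.2 + T).toNat : ℕ) : ℤ) = c.2 + T := by
  have := h.1; omega

/-- The head wire of a configuration of the window. [folklore] -/
def headFin (h : PCfg.InWindow x.length s c) (hs : s ≤ T) : Fin (Wd x.length T) :=
  ⟨(c.2 + T).toNat, headIdx_lt h hs⟩

/-- `enc` marks exactly the head cell on the head track. [folklore] -/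
theorem enc_head (h : PCfg.InWindow x.length s c) (hs : s ≤ T) (j : Fin (Wd x.length T)) :
    enc x T c (.head j) = decide (j = headFin h hs) := by
  have hc := headIdx_cast h hs
  simp only [enc, headFin, Fin.ext_iff]
  by_cases hj : c.2 + T = j
  · rw [decide_eq_true hj, decide_eq_true (by omega)]
  · rw [decide_eq_false hj, decide_eq_false (by omega)]

/-- `enc` marks exactly the head cell on the head track (indices as naturals). [folklore] -/
theorem enc_head_val (h : PCfg.InWindow x.length s c) (hs : s ≤ T) (j : Fin (Wd x.length T)) :
    enc x T c (.head j) = decide ((j : ℕ) = (c.2 + T).toNat) := by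
  rw [enc_head h hs]
  simp [headFin, Fin.ext_iff]

/-- The scanned cell of `enc` holds the scanned symbol. [folklore] -/
theorem enc_cell_headFin (h : PCfg.InWindow x.length s c) (hs : s ≤ T) (τ : M.Γ) :
    enc x T c (.cell (headFin h hs) τ) = decide (c.1.tape.head = τ) := by
  simp only [enc, headFin, headIdx_cast h hs, add_sub_cancel_right, PCfg.cells_snd]

/-! ### `fetch`: the scanned cell into the register, and back -/

variable (M) in
/-- **Fetching the scanned symbol.** For every cell `j` of the window, Fredkin gates controlled
by `head j` exchange the wires of cell `j` with the symbol register (only the scanned cell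
fires). [cite: NishimuraOzawa2002, Thm. 4.3 (proof)] -/
def fetch (n W : ℕ) : List (ClOp (YW M n W)) :=
  (List.finRange W).flatMap fun j => cswapRegs (YW.head j) (cellL j) (regL M n W)

/-- Well-formedness of `fetch`. [folklore] -/
theorem wf_of_mem_fetch {op : ClOp (YW M n W)} (hop : op ∈ fetch M n W) : op.WF := by
  simp only [fetch, List.mem_flatMap] at hop
  obtain ⟨j, -, hop⟩ := hop
  refine wf_of_mem_cswapRegs (by simp [cellL]) (by simp [regL]) (fun k a b ha hb => ?_) hop
  simp only [cellL, regL, List.getElem?_map] at ha hb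
  cases hk : (symList M)[k]? with
  | none => simp [hk] at ha
  | some τ => simp [hk] at ha hb; rw [← ha, ← hb]; simp

/-- The targets of `fetch` are cell and register wires. [folklore] -/
theorem target_of_mem_fetch {op : ClOp (YW M n W)} (hop : op ∈ fetch M n W) :
    (∃ j τ, op.target = YW.cell j τ) ∨ ∃ τ, op.target = YW.reg τ := by
  simp only [fetch, List.mem_flatMap] at hop
  obtain ⟨j, -, hop⟩ := hop
  rcases target_mem_of_mem_cswapRegs hop with h | h
  · simp only [cellL, List.mem_map] at h
    obtain ⟨τ, -, hτ⟩ := h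
    exact Or.inl ⟨j, τ, hτ.symm⟩
  · simp only [regL, List.mem_map] at h
    obtain ⟨τ, -, hτ⟩ := h
    exact Or.inr ⟨τ, hτ.symm⟩

/-- One cell block of `fetch` with its control off is the identity. [folklore] -/
theorem clEval_fetchBlock_of_false (j : Fin W) (w : YW M n W → Bool) (hw : w (.head j) = false) :
    clEval (cswapRegs (YW.head j) (cellL j) (regL M n W)) w = w :=
  clEval_cswapRegs_of_false (by simp [cellL]) (by simp [regL]) (fun k a b ha hb => by
    simp only [cellL, regL, List.getElem?_map] at ha hb
    cases hk : (symList M)[k]? with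
    | none => simp [hk] at ha
    | some τ => simp [hk] at ha hb; rw [← ha, ← hb]; simp) w hw

/-- One cell block of `fetch` with its control set exchanges cell `j` and the register. [folklore] -/
theorem clEval_fetchBlock_of_true (j : Fin W) (w : YW M n W → Bool) (hw : w (.head j) = true) :
    clEval (cswapRegs (YW.head j) (cellL j) (regL M n W)) w =
      fun i => match i with
        | .cell j' τ => if j' = j then w (.reg τ) else w (.cell j' τ)
        | .reg τ => w (.cell j τ)
        | i => w i := by
  obtain ⟨h₁, h₂⟩ := clEval_cswapRegs_of_true (c := YW.head j) (as := cellL j)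
    (bs := regL M n W) (by simp [cellL]) (by simp [regL])
    (nodup_symList.map fun a b h => by simpa using h)
    (nodup_symList.map fun a b h => by simpa using h)
    (fun a ha hb => by
      simp only [cellL, regL, List.mem_map] at ha hb
      obtain ⟨τ, -, rfl⟩ := ha
      obtain ⟨τ', -, h⟩ := hb
      simp at h)
    (by simp [cellL, regL]) w hw
  have hk : ∀ τ : M.Γ, ∃ k : ℕ, (cellL (n := n) j)[k]? = some (YW.cell j τ) ∧
      (regL M n W)[k]? = some (YW.reg τ) := fun τ => by
    obtain ⟨k, hk⟩ := List.getElem?_of_mem (mem_symList τ)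
    exact ⟨k, by simp [cellL, hk], by simp [regL, hk]⟩
  funext i
  cases i with
  | inp i => exact h₂ _ (by simp [cellL]) (by simp [regL])
  | st q => exact h₂ _ (by simp [cellL]) (by simp [regL])
  | reg τ =>
    obtain ⟨k, hk₁, hk₂⟩ := hk τ
    exact (h₁ k _ _ hk₁ hk₂).2
  | dir => exact h₂ _ (by simp [cellL]) (by simp [regL])
  | ans => exact h₂ _ (by simp [cellL]) (by simp [regL])
  | cell j' τ =>
    by_cases hj : j' = j
    · subst hj
      obtain ⟨k, hk₁, hk₂⟩ := hk τ
      simp only [if_true]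
      exact (h₁ k _ _ hk₁ hk₂).1
    · simp only [hj, if_false]
      refine h₂ _ (fun hmem => ?_) (by simp [regL])
      simp only [cellL, List.mem_map] at hmem
      obtain ⟨τ', -, e⟩ := hmem
      injection e with e₁
      exact hj e₁.symm
  | head j' => exact h₂ _ (by simp [cellL]) (by simp [regL])

/-- `fetch` on an assignment whose head track is one-hot at `j₀`: only the block of `j₀` acts. [folklore] -/
theorem clEval_fetch_of_oneHot (j₀ : Fin W) (w : YW M n W → Bool)
    (hw : ∀ j : Fin W, w (.head j) = decide (j = j₀)) :
    clEval (fetch M n W) w = clEval (cswapRegs (YW.head j₀) (cellL j₀) (regL M n W)) w := by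
  unfold fetch
  -- the blocks never touch the head track
  have hheads : ∀ (j j' : Fin W) (w : YW M n W → Bool),
      clEval (cswapRegs (YW.head j) (cellL j) (regL M n W)) w (.head j') = w (.head j') :=
    fun j j' w => clEval_apply_of_forall_target_ne _ _ fun op hop e => by
      rcases target_mem_of_mem_cswapRegs hop with h | h
      · simp [cellL, e] at h
      · simp [regL, e] at h
  suffices H : ∀ l : List (Fin W), l.Nodup → ∀ w : YW M n W → Bool,
      (∀ j : Fin W, w (.head j) = decide (j = j₀)) →
      clEval (l.flatMap fun j => cswapRegs (YW.head j) (cellL j) (regL M n W)) w =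
        if j₀ ∈ l then clEval (cswapRegs (YW.head j₀) (cellL j₀) (regL M n W)) w else w by
    rw [H _ (List.nodup_finRange W) w hw, if_pos (List.mem_finRange j₀)]
  intro l hl
  induction l with
  | nil => intro w _; simp
  | cons j l ih =>
    intro w hw
    rw [List.nodup_cons] at hl
    rw [List.flatMap_cons, clEval_append]
    by_cases hj : j = j₀
    · subst hj
      rw [ih hl.2 _ (fun j' => by rw [hheads, hw]), if_neg hl.1, if_pos (by simp)]
    · rw [clEval_fetchBlock_of_false j w (by rw [hw]; simp [hj]), ih hl.2 w hw]
      simp [Ne.symm hj]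

/-- **`fetch` on an encoded configuration**: the scanned symbol moves into the register. [cite: NishimuraOzawa2002, Thm. 4.3 (proof)] -/
theorem clEval_fetch_enc (h : PCfg.InWindow x.length s c) (hs : s ≤ T) :
    clEval (fetch M x.length (Wd x.length T)) (enc x T c) = fetched x T c := by
  rw [clEval_fetch_of_oneHot (headFin h hs) _ (enc_head h hs),
    clEval_fetchBlock_of_true _ _ (by rw [enc_head h hs]; simp)]
  funext i
  cases i with
  | inp i => rfl
  | st q => rfl
  | reg τ => exact enc_cell_headFin h hs τ
  | dir => rfl
  | ans => rfl
  | cell j' τ =>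
    simp only [fetched, enc]
    by_cases hj : j' = headFin h hs
    · subst hj
      simp [headFin, headIdx_cast h hs]
    · have : ¬ (c.2 + T = j') := fun e => hj (Fin.ext (by
        simp only [headFin]; have := headIdx_cast h hs; omega))
      simp [hj, this]
  | head j' => rfl

/-- **`fetch` after the local unitary**: the written symbol moves back into the scanned cell and
the register is clear again. [cite: NishimuraOzawa2002, Thm. 4.3 (proof)] -/
theorem clEval_fetch_applied (h : PCfg.InWindow x.length s c) (hs : s ≤ T) (q' : M.Λ) (b : M.Γ) :
    clEval (fetch M x.length (Wd x.length T)) (applied x T c q' b) = written x T c q' b := by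
  have hhead : ∀ j : Fin (Wd x.length T), applied x T c q' b (.head j) = decide (j = headFin h hs) :=
    fun j => enc_head h hs j
  rw [clEval_fetch_of_oneHot (headFin h hs) _ hhead,
    clEval_fetchBlock_of_true _ _ (by rw [hhead]; simp)]
  funext i
  cases i with
  | inp i => rfl
  | st q => rfl
  | reg τ =>
    show applied x T c q' b (.cell (headFin h hs) τ) = false
    simp [applied, fetched, headFin, headIdx_cast h hs]
  | dir => rfl
  | ans => rfl
  | cell j' τ =>
    simp only [written, applied, fetched]
    by_cases hj : j' = headFin h hs
    · subst hj
      simp [headFin, headIdx_cast h hs]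
    · have : ¬ (c.2 + T = j') := fun e => hj (Fin.ext (by
        simp only [headFin]; have := headIdx_cast h hs; omega))
      simp [hj, this]
  | head j' => rfl

end Semantics

/-! ### `move`: the head marker follows the direction of the new state -/

section Move

variable (M) in
/-- The states entered while moving right (Bernstein–Vazirani 1997, Def. 3.14). [cite: BernsteinVaziraniSICOMP1997, Def. 3.14] -/
def rightStates (D : M.Λ → Dir) : List M.Λ :=
  (stList M).filter fun q => decide (D q = Dir.right)

/-- Membership in `rightStates`. [folklore] -/
theorem mem_rightStates {D : M.Λ → Dir} {q : M.Λ} : q ∈ rightStates M D ↔ D q = Dir.right := by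
  simp [rightStates, mem_stList]

/-- `rightStates` has no duplicates. [folklore] -/
theorem nodup_rightStates (D : M.Λ → Dir) : (rightStates M D).Nodup :=
  nodup_stList.filter _

variable (M) in
/-- **Moving the head marker.** Compute the direction bit `dir = [D q' = R]` as the parity of the
state wires of the right-moving states (the state register being one-hot at the new state
`q'`), rotate the head track to the right under `dir`, flip `dir`, rotate to the left under
`dir` (i.e. when `D q' = L`), flip back and uncompute `dir` (Nishimura–Ozawa 2002, proof of
Thm. 4.3, the gate `G₂` moving the head mark; Bernstein–Vazirani 1997, Def. 3.14: the direction
is a function of the state entered). [cite: NishimuraOzawa2002, Thm. 4.3 (proof)] -/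
def move (D : M.Λ → Dir) (n W : ℕ) : List (ClOp (YW M n W)) :=
  xorInto ((rightStates M D).map YW.st) YW.dir ++
    (rotR YW.dir (hTrack M n W) W ++
      ([ClOp.not YW.dir] ++
        (rotL YW.dir (hTrack M n W) W ++
          ([ClOp.not YW.dir] ++ xorInto ((rightStates M D).map YW.st) YW.dir))))

/-- Well-formedness of `move`. [folklore] -/
theorem wf_of_mem_move {D : M.Λ → Dir} {op : ClOp (YW M n W)} (hop : op ∈ move M D n W) :
    op.WF := by
  simp only [move, List.mem_append, List.mem_singleton] at hop
  have hx : ∀ {op : ClOp (YW M n W)}, op ∈ xorInto ((rightStates M D).map YW.st) YW.dir → op.WF :=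
    fun hop => wf_of_mem_xorInto (by simp) hop
  rcases hop with hop | hop | hop | hop | hop | hop
  · exact hx hop
  · exact wf_of_mem_rotR dir_ne_hTrack hTrack_inj hop
  · subst hop; trivial
  · exact wf_of_mem_rotL dir_ne_hTrack hTrack_inj hop
  · subst hop; trivial
  · exact hx hop

/-- The targets of `move` are the direction wire and head wires. [folklore] -/
theorem target_of_mem_move {D : M.Λ → Dir} {op : ClOp (YW M n W)} (hop : op ∈ move M D n W) :
    op.target = YW.dir ∨ ∃ j, op.target = YW.head j := by
  simp only [move, List.mem_append, List.mem_singleton] at hop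
  have hx : ∀ {op : ClOp (YW M n W)}, op ∈ xorInto ((rightStates M D).map YW.st) YW.dir →
      op.target = YW.dir := fun hop => by
    simp only [xorInto, List.mem_map] at hop
    obtain ⟨s, -, rfl⟩ := hop
    rfl
  have hsw : ∀ {op : ClOp (YW M n W)} {j : ℕ}, j + 1 < W →
      op ∈ cswap YW.dir (hTrack M n W j) (hTrack M n W (j + 1)) → ∃ j', op.target = YW.head j' :=
    fun hj hop => by
      rcases target_mem_of_mem_cswap hop with h | h
      · exact ⟨_, h.trans (hTrack_of_lt (by omega))⟩
      · exact ⟨_, h.trans (hTrack_of_lt hj)⟩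
  rcases hop with hop | hop | hop | hop | hop | hop
  · exact Or.inl (hx hop)
  · obtain ⟨j, hj, hop⟩ := exists_of_mem_rotR hop
    exact Or.inr (hsw hj hop)
  · subst hop; exact Or.inl rfl
  · obtain ⟨j, hj, hop⟩ := exists_of_mem_rotL hop
    exact Or.inr (hsw hj hop)
  · subst hop; exact Or.inl rfl
  · exact Or.inl (hx hop)

/-- The direction bit of a one-hot state register: the parity of the right-moving state wires
is `[D q' = R]`. [cite: BernsteinVaziraniSICOMP1997, Def. 3.14] -/
theorem parity_rightStates {D : M.Λ → Dir} (w : YW M n W → Bool) (q' : M.Λ)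
    (hst : ∀ q, w (.st q) = decide (q' = q)) :
    parity w ((rightStates M D).map YW.st) = decide (D q' = Dir.right) := by
  by_cases hD : D q' = Dir.right
  · rw [decide_eq_true hD]
    refine parity_eq_true_of_unique w ((nodup_rightStates D).map fun a b h => by simpa using h)
      (a := YW.st q') (List.mem_map.2 ⟨q', mem_rightStates.2 hD, rfl⟩) (by rw [hst]; simp) ?_
    intro s hs hne
    obtain ⟨q, -, rfl⟩ := List.mem_map.1 hs
    rw [hst]
    simpa using fun h => hne (by rw [h])
  · rw [decide_eq_false hD]
    refine parity_eq_false_of_forall w fun s hs => ?_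
    obtain ⟨q, hq, rfl⟩ := List.mem_map.1 hs
    rw [hst]
    exact decide_eq_false fun h => hD (h ▸ mem_rightStates.1 hq)

/-- A single `NOT` on `dir`. [folklore] -/
theorem clEval_not_dir (w : YW M n W → Bool) :
    clEval [ClOp.not YW.dir] w = update w YW.dir (!w YW.dir) := by
  simp [ClOp.eval_not]

/-- **Semantics of `move`.** On an assignment with clear direction bit, state register one-hot at
`q'` and head track one-hot at a cell `j₀` with `1 ≤ j₀` and `j₀ + 1 < W`, `move` relocates the
head marker to `j₀ + 1` if `D q' = R` and to `j₀ - 1` otherwise, and changes nothing else. [cite: NishimuraOzawa2002, Thm. 4.3 (proof)] -/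
theorem clEval_move {D : M.Λ → Dir} (w : YW M n W → Bool) (q' : M.Λ) (j₀ : ℕ) (hj₀ : 1 ≤ j₀)
    (hj₀W : j₀ + 1 < W) (hdir : w .dir = false) (hst : ∀ q, w (.st q) = decide (q' = q))
    (hhead : ∀ j : Fin W, w (.head j) = decide ((j : ℕ) = j₀)) :
    clEval (move M D n W) w = fun i => match i with
      | .head j => decide ((j : ℕ) = if D q' = Dir.right then j₀ + 1 else j₀ - 1)
      | i => w i := by
  have hpar : ∀ w' : YW M n W → Bool, (∀ q, w' (.st q) = w (.st q)) →
      parity w' ((rightStates M D).map YW.st) = decide (D q' = Dir.right) :=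
    fun w' hw' => parity_rightStates w' q' fun q => (hw' q).trans (hst q)
  -- stage 1: compute the direction bit
  set w₁ : YW M n W → Bool := update w .dir (decide (D q' = Dir.right)) with hw₁
  have h₁ : clEval (xorInto ((rightStates M D).map YW.st) YW.dir) w = w₁ := by
    funext i
    by_cases hi : i = YW.dir
    · subst hi
      rw [clEval_xorInto_target (by simp), hdir, hpar w fun _ => rfl, hw₁, update_self]
      simp
    · rw [clEval_xorInto_of_ne w hi, hw₁, update_of_ne hi]
  -- the track of `w₁`
  have htr₁ : ∀ j < W, w₁ (hTrack M n W j) = decide (j = j₀) := fun j hj => by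
    rw [hw₁, hTrack_of_lt hj, update_of_ne (by simp), hhead]
  unfold move
  rw [clEval_append, h₁]
  by_cases hD : D q' = Dir.right
  · -- moving right: `rotR` fires, `rotL` does not
    have hd₁ : w₁ .dir = true := by rw [hw₁, update_self]; exact decide_eq_true hD
    obtain ⟨hR₀, hR₁, hR₂⟩ := clEval_rotR_of_true w₁ hd₁ W dir_ne_hTrack hTrack_inj
    set w₂ := clEval (rotR YW.dir (hTrack M n W) W) w₁ with hw₂
    have hw₂eq : w₂ = fun i => match i with
        | .head j => decide ((j : ℕ) = j₀ + 1) | i => w₁ i := by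
      funext i
      cases i with
      | head j =>
        obtain ⟨j, hj⟩ := j
        cases j with
        | zero =>
          have := hR₂ (by omega)
          rw [hTrack_of_lt (by omega), htr₁ _ (by omega)] at this
          rw [this]; simp; omega
        | succ j =>
          have := hR₁ j hj
          rw [hTrack_of_lt hj, htr₁ _ (by omega)] at this
          rw [this]; simp
      | inp i => exact hR₀ _ fun j hj => by rw [hTrack_of_lt hj]; simp
      | st q => exact hR₀ _ fun j hj => by rw [hTrack_of_lt hj]; simp
      | reg τ => exact hR₀ _ fun j hj => by rw [hTrack_of_lt hj]; simp
      | dir => exact hR₀ _ fun j hj => by rw [hTrack_of_lt hj]; simp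
      | ans => exact hR₀ _ fun j hj => by rw [hTrack_of_lt hj]; simp
      | cell j τ => exact hR₀ _ fun j hj => by rw [hTrack_of_lt hj]; simp
    rw [clEval_append, ← hw₂, clEval_append, clEval_not_dir]
    set w₃ := update w₂ YW.dir (!w₂ YW.dir) with hw₃
    have hd₃ : w₃ .dir = false := by
      rw [hw₃, update_self, hw₂eq]; simp only; rw [hd₁]; rfl
    rw [clEval_append, clEval_rotL_of_false dir_ne_hTrack hTrack_inj w₃ hd₃, clEval_append,
      clEval_not_dir]
    set w₄ := update w₃ YW.dir (!w₃ YW.dir) with hw₄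
    have hp₄ : parity w₄ ((rightStates M D).map YW.st) = decide (D q' = Dir.right) :=
      hpar w₄ fun q => by
        rw [hw₄, update_of_ne (by simp), hw₃, update_of_ne (by simp), hw₂eq]; simp [hw₁]
    funext i
    by_cases hi : i = YW.dir
    · subst hi
      rw [clEval_xorInto_target (by simp), hp₄, hw₄, update_self, hd₃]
      simp [hD, hdir]
    · rw [clEval_xorInto_of_ne _ hi, hw₄, update_of_ne hi, hw₃, update_of_ne hi, hw₂eq]
      cases i with
      | head j => simp [hD]
      | dir => exact absurd rfl hi
      | inp i => simp [hw₁]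
      | st q => simp [hw₁]
      | reg τ => simp [hw₁]
      | ans => simp [hw₁]
      | cell j τ => simp [hw₁]
  · -- moving left: `rotR` does not fire, `rotL` does
    have hd₁ : w₁ .dir = false := by rw [hw₁, update_self]; exact decide_eq_false hD
    rw [clEval_append, clEval_rotR_of_false w₁ hd₁ W dir_ne_hTrack hTrack_inj, clEval_append,
      clEval_not_dir]
    set w₃ := update w₁ YW.dir (!w₁ YW.dir) with hw₃
    have hd₃ : w₃ .dir = true := by rw [hw₃, update_self, hd₁]; rfl
    have htr₃ : ∀ j < W, w₃ (hTrack M n W j) = decide (j = j₀) := fun j hj => by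
      rw [hw₃, update_of_ne (dir_ne_hTrack j hj).symm, htr₁ j hj]
    obtain ⟨hL₀, hL₁, hL₂⟩ := clEval_rotL_of_true dir_ne_hTrack hTrack_inj (by omega) w₃ hd₃
    set w₄ := clEval (rotL YW.dir (hTrack M n W) W) w₃ with hw₄
    have hw₄eq : w₄ = fun i => match i with
        | .head j => decide ((j : ℕ) = j₀ - 1) | i => w₃ i := by
      funext i
      cases i with
      | head j =>
        obtain ⟨j, hj⟩ := j
        rcases Nat.lt_or_ge (j + 1) W with hj' | hj'
        · have := hL₁ j hj'
          rw [hTrack_of_lt hj, htr₃ _ hj'] at this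
          rw [this]; simp; omega
        · obtain rfl : j = W - 1 := by omega
          have := hL₂
          rw [hTrack_of_lt hj, htr₃ _ (by omega)] at this
          rw [this]; simp; omega
      | inp i => exact hL₀ _ fun j hj => by rw [hTrack_of_lt hj]; simp
      | st q => exact hL₀ _ fun j hj => by rw [hTrack_of_lt hj]; simp
      | reg τ => exact hL₀ _ fun j hj => by rw [hTrack_of_lt hj]; simp
      | dir => exact hL₀ _ fun j hj => by rw [hTrack_of_lt hj]; simp
      | ans => exact hL₀ _ fun j hj => by rw [hTrack_of_lt hj]; simp
      | cell j τ => exact hL₀ _ fun j hj => by rw [hTrack_of_lt hj]; simp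
    rw [clEval_append, ← hw₄, clEval_append, clEval_not_dir]
    set w₅ := update w₄ YW.dir (!w₄ YW.dir) with hw₅
    have hd₅ : w₅ .dir = false := by
      rw [hw₅, update_self, hw₄eq]; simp only; rw [hd₃]; rfl
    have hp₅ : parity w₅ ((rightStates M D).map YW.st) = decide (D q' = Dir.right) :=
      hpar w₅ fun q => by rw [hw₅, update_of_ne (by simp), hw₄eq]; simp [hw₃, hw₁]
    funext i
    by_cases hi : i = YW.dir
    · subst hi
      rw [clEval_xorInto_target (by simp), hp₅, hd₅]
      simp [hD, hdir]
    · rw [clEval_xorInto_of_ne _ hi, hw₅, update_of_ne hi, hw₄eq]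
      cases i with
      | head j => simp [hD]
      | dir => exact absurd rfl hi
      | inp i => simp [hw₃, hw₁]
      | st q => simp [hw₃, hw₁]
      | reg τ => simp [hw₃, hw₁]
      | ans => simp [hw₃, hw₁]
      | cell j τ => simp [hw₃, hw₁]

variable {x : List Bool} {T s : ℕ} {c : M.PCfg}

/-- **`move` after write-back**: the head marker moves to the cell of the new head position, so
that the label of the step target `|q', T_ξ^b, ξ ± 1⟩` is reached
(`QTM.pevolve_single_of_unidirectional`). Needs `s < T` steps done so far (no wrap-around). [cite: NishimuraOzawa2002, Thm. 4.3 (proof)] -/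
theorem clEval_move_written {D : M.Λ → Dir} (h : PCfg.InWindow x.length s c) (hs : s < T)
    (q' : M.Λ) (b : M.Γ) :
    clEval (move M D x.length (Wd x.length T)) (written x T c q' b) =
      enc x T (M.pupdTarget c (boolOfDir (D q'), q', b)) := by
  have hc := headIdx_cast h hs.le
  have h1 := h.1; have h2 := h.2.1
  rw [clEval_move (written x T c q' b) q' (c.2 + T).toNat (by omega)
    (by show (c.2 + T).toNat + 1 < 2 * T + x.length + 1; omega) rfl (fun q => rfl)
    (fun j => enc_head_val h hs.le j)]
  funext i
  cases i with
  | head j =>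
    simp only [enc, snd_pupdTarget]
    cases hD : D q' <;> simp [boolOfDir] <;> omega
  | inp i => rfl
  | st q => rfl
  | reg τ => rfl
  | dir => rfl
  | ans => rfl
  | cell j τ =>
    simp only [written, enc, cells_pupdTarget, Function.update_apply]
    by_cases hj : c.2 + T = j
    · rw [if_pos hj, if_pos (by omega)]
    · rw [if_neg hj, if_neg (by omega)]

end Move

/-! ### Initialisation: the label of the initial configuration from the padded input -/

section Init

variable (M) in
/-- The padded input `|x⟩|0…0⟩` as an assignment of the wires: the input wires hold `x`, all
other wires are clear. [folklore] -/
def inputAssign (x : List Bool) (T : ℕ) : YW M x.length (Wd x.length T) → Bool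
  | .inp i => x[i]
  | _ => false

variable (M) in
/-- **Initialisation.** Blank codes into the cells outside the input (a `NOT` on their blank
wire), the code of the input symbol `embed xᵢ` into cell `T + i` (selective writes controlled
by the input wire `i`), the start state into the state register and the head marker at cell
`T` (the start cell `0`): the label of `QTM.pinit x` (Bernstein–Vazirani 1997, Def. 3.2, initial
configuration; Nishimura–Ozawa 2002, proof of Thm. 4.3, the input state of the first `K₂K₁`). [cite: NishimuraOzawa2002, Thm. 4.3 (proof)] -/
def initOps (n T : ℕ) : List (ClOp (YW M n (Wd n T))) :=
  ((List.finRange (Wd n T)).filter fun j : Fin (Wd n T) => !decide (T ≤ j.val ∧ j.val < T + n)).map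
      (fun j => ClOp.not (YW.cell j default)) ++
    ((List.finRange n).flatMap fun i : Fin n =>
      writeSel (YW.inp i) (fun τ => YW.cell ⟨T + i, by dsimp only [Wd]; omega⟩ τ)
        (fun τ => decide (M.embed false = τ)) (fun τ => decide (M.embed true = τ)) (symList M)) ++
    [ClOp.not (YW.st M.start), ClOp.not (YW.head ⟨T, by dsimp only [Wd]; omega⟩)]

/-- The input cell `T + i` as an element of `Fin W`. [folklore] -/
abbrev inCell (n T : ℕ) (i : Fin n) : Fin (Wd n T) := ⟨T + i, by dsimp only [Wd]; omega⟩

/-- Well-formedness of `initOps`. [folklore] -/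
theorem wf_of_mem_initOps {T : ℕ} {op : ClOp (YW M n (Wd n T))} (hop : op ∈ initOps M n T) :
    op.WF := by
  simp only [initOps, List.mem_append, List.mem_map, List.mem_flatMap, List.mem_cons,
    List.not_mem_nil, or_false] at hop
  rcases hop with (⟨j, -, rfl⟩ | ⟨i, -, hop⟩) | rfl | rfl
  · trivial
  · exact wf_of_mem_writeSel (fun _ _ => by simp) hop
  · trivial
  · trivial

/-- No target of `initOps` is a control of `initOps` (the only controls are input wires). [folklore] -/
theorem target_not_mem_controls_initOps {T : ℕ} {op op' : ClOp (YW M n (Wd n T))}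
    (hop : op ∈ initOps M n T) (hop' : op' ∈ initOps M n T) : op'.target ∉ op.controls := by
  -- controls of `initOps` are input wires
  have hctrl : ∀ c ∈ op.controls, ∃ i, c = YW.inp i := by
    simp only [initOps, List.mem_append, List.mem_map, List.mem_flatMap, List.mem_cons,
      List.not_mem_nil, or_false] at hop
    rcases hop with (⟨j, -, rfl⟩ | ⟨i, -, hop⟩) | rfl | rfl
    · simp [ClOp.controls]
    · obtain ⟨k, -, rfl | rfl⟩ := exists_of_mem_writeSel hop
      · simp [ClOp.controls]
      · simp [ClOp.controls]
    · simp [ClOp.controls]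
    · simp [ClOp.controls]
  -- targets are not input wires
  have htgt : ∀ i, op'.target ≠ YW.inp i := by
    simp only [initOps, List.mem_append, List.mem_map, List.mem_flatMap, List.mem_cons,
      List.not_mem_nil, or_false] at hop'
    rcases hop' with (⟨j, -, rfl⟩ | ⟨i, -, hop⟩) | rfl | rfl
    · simp [ClOp.target]
    · obtain ⟨k, -, rfl | rfl⟩ := exists_of_mem_writeSel hop
      · simp [ClOp.target]
      · simp [ClOp.target]
    · simp [ClOp.target]
    · simp [ClOp.target]
  intro hmem
  obtain ⟨i, hi⟩ := hctrl _ hmem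
  exact htgt i hi

/-- `clToggle` of negations on a duplicate-free list of wires: exactly the listed wires are
toggled. [folklore] -/
theorem clToggle_map_not {ι : Type*} [DecidableEq ι] (L : List ι) (hL : L.Nodup) (w : ι → Bool)
    (i : ι) : clToggle (L.map ClOp.not) w i = decide (i ∈ L) := by
  by_cases hi : i ∈ L
  · rw [decide_eq_true hi]
    have := clToggle_eq_guard_of_nodup (L.map ClOp.not) w
      (by rw [List.map_map, show ClOp.target ∘ ClOp.not = (id : ι → ι) from rfl, List.map_id]
          exact hL)
      (op := ClOp.not i) (List.mem_map.2 ⟨i, hi, rfl⟩)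
    simpa [ClOp.target, ClOp.guard] using this
  · rw [decide_eq_false hi]
    exact clToggle_eq_false_of_forall_ne _ _ fun op hop => by
      obtain ⟨a, ha, rfl⟩ := List.mem_map.1 hop
      exact fun e => hi (by simpa [ClOp.target] using e ▸ ha)

/-- `clToggle` of one selective write at its target: `e₀ k ⊕ (w x ∧ (e₀ k ≠ e₁ k))`. [folklore] -/
theorem clToggle_writeSel_tgt {ι κ : Type*} [DecidableEq ι] {x : ι} {tgt : κ → ι}
    {e₀ e₁ : κ → Bool} {ks : List κ} (hnd : ks.Nodup)
    (hinj : ∀ k ∈ ks, ∀ k' ∈ ks, tgt k = tgt k' → k = k') (w : ι → Bool) {k : κ} (hk : k ∈ ks) :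
    clToggle (writeSel x tgt e₀ e₁ ks) w (tgt k) = (e₀ k ^^ (w x && (e₀ k != e₁ k))) := by
  unfold writeSel
  rw [clToggle_flatMap_of_forall_ne _ _ w (tgt k) k hnd hk]
  · by_cases h₀ : e₀ k = true <;> by_cases h₁ : e₁ k = true <;>
      simp [h₀, h₁, ClOp.target, ClOp.guard]
  · intro k' hk' hne op hop
    simp only [List.mem_append] at hop
    have hne' : tgt k' ≠ tgt k := fun e => hne (hinj k' hk' k hk e)
    rcases hop with hop | hop <;> split_ifs at hop <;> simp at hop <;> subst hop <;>
      simpa [ClOp.target] using hne'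

/-- `clToggle` of a selective write off its targets. [folklore] -/
theorem clToggle_writeSel_of_forall_ne {ι κ : Type*} [DecidableEq ι] {x : ι} {tgt : κ → ι}
    {e₀ e₁ : κ → Bool} {ks : List κ} (w : ι → Bool) {i : ι} (hi : ∀ k ∈ ks, i ≠ tgt k) :
    clToggle (writeSel x tgt e₀ e₁ ks) w i = false :=
  clToggle_eq_false_of_forall_ne _ _ fun op hop => by
    obtain ⟨k, hk, rfl | rfl⟩ := exists_of_mem_writeSel hop
    · exact (hi k hk).symm
    · exact (hi k hk).symm

variable {x : List Bool} {T : ℕ}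

/-- **Semantics of `initOps`**: from the padded input it produces the label of the initial
configuration `(start, x written from cell 0, head at 0)`. [cite: NishimuraOzawa2002, Thm. 4.3 (proof)] -/
theorem clEval_initOps_inputAssign (x : List Bool) (T : ℕ) :
    clEval (initOps M x.length T) (inputAssign M x T) = enc x T (M.pinit x) := by
  set n := x.length with hn
  funext i
  rw [clEval_apply_of_disjoint _ (fun op hop op' hop' => target_not_mem_controls_initOps hop hop')]
  simp only [initOps, clToggle_append, clToggle_cons, clToggle_nil, Bool.xor_false]
  -- the three parts of the toggle
  have hA : ∀ i : YW M n (Wd n T),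
      clToggle (((List.finRange (Wd n T)).filter fun j : Fin (Wd n T) =>
        !decide (T ≤ j.val ∧ j.val < T + n)).map (fun j => ClOp.not (YW.cell j default)))
        (inputAssign M x T) i =
      decide (∃ j : Fin (Wd n T), ¬ (T ≤ (j : ℕ) ∧ (j : ℕ) < T + n) ∧ i = YW.cell j default) := by
    intro i
    have := clToggle_map_not ((((List.finRange (Wd n T)).filter fun j : Fin (Wd n T) =>
        !decide (T ≤ j.val ∧ j.val < T + n)).map (fun j => YW.cell j default)))
      (((List.nodup_finRange _).filter _).map fun a b h => by simpa using h) (inputAssign M x T) i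
    rw [List.map_map] at this
    rw [show (fun j : Fin (Wd n T) => ClOp.not (YW.cell j (default : M.Γ))) =
      ClOp.not ∘ (fun j => YW.cell j default) from rfl, this]
    congr 1
    simp only [List.mem_map, List.mem_filter, List.mem_finRange, true_and, Bool.not_eq_true',
      decide_eq_false_iff_not, eq_iff_iff]
    exact ⟨fun ⟨j, hj, e⟩ => ⟨j, hj, e.symm⟩, fun ⟨j, hj, e⟩ => ⟨j, hj, e.symm⟩⟩
  have hB_tgt : ∀ (i₀ : Fin n) (τ : M.Γ),
      clToggle ((List.finRange n).flatMap fun i : Fin n =>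
        writeSel (YW.inp i) (fun τ => YW.cell (inCell n T i) τ)
          (fun τ => decide (M.embed false = τ)) (fun τ => decide (M.embed true = τ)) (symList M))
        (inputAssign M x T) (YW.cell (inCell n T i₀) τ) = decide (M.embed x[i₀] = τ) := by
    intro i₀ τ
    rw [clToggle_flatMap_of_forall_ne _ _ _ _ i₀ (List.nodup_finRange n) (List.mem_finRange i₀)]
    · rw [clToggle_writeSel_tgt (tgt := fun τ => YW.cell (inCell n T i₀) τ) nodup_symList
        (fun k _ k' _ h => by simpa using h) _ (mem_symList τ)]
      simp only [inputAssign, Fin.getElem_fin]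
      cases x[(i₀ : ℕ)] <;> cases decide (M.embed false = τ) <;> cases decide (M.embed true = τ) <;> rfl
    · intro i hi hne op hop
      obtain ⟨k, hk, rfl | rfl⟩ := exists_of_mem_writeSel hop <;>
      · simp only [ClOp.target, ne_eq, YW.cell.injEq, Fin.ext_iff, not_and]
        intro h; exact absurd (Fin.ext (by simpa using h)) hne
  have hB_off : ∀ i : YW M n (Wd n T), (∀ (i₀ : Fin n) (τ : M.Γ), i ≠ YW.cell (inCell n T i₀) τ) →
      clToggle ((List.finRange n).flatMap fun i : Fin n =>
        writeSel (YW.inp i) (fun τ => YW.cell (inCell n T i) τ)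
          (fun τ => decide (M.embed false = τ)) (fun τ => decide (M.embed true = τ)) (symList M))
        (inputAssign M x T) i = false := fun i hi =>
    clToggle_flatMap_eq_false _ _ _ _ fun i₀ _ op hop => by
      obtain ⟨k, hk, rfl | rfl⟩ := exists_of_mem_writeSel hop
      · exact (hi i₀ k).symm
      · exact (hi i₀ k).symm
  rw [hA]
  cases i with
  | inp i =>
    rw [hB_off _ (by simp)]
    simp [inputAssign, enc, ClOp.target]
  | st q =>
    rw [hB_off _ (by simp)]
    by_cases hq : M.start = q <;> simp [inputAssign, enc, ClOp.target, ClOp.guard, hq]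
  | reg τ =>
    rw [hB_off _ (by simp)]
    simp [inputAssign, enc, ClOp.target]
  | dir =>
    rw [hB_off _ (by simp)]
    simp [inputAssign, enc, ClOp.target]
  | ans =>
    rw [hB_off _ (by simp)]
    simp [inputAssign, enc, ClOp.target]
  | head j =>
    rw [hB_off _ (by simp)]
    simp [inputAssign, enc, ClOp.target, ClOp.guard, Fin.ext_iff]
  | cell j τ =>
    simp only [inputAssign, enc, ClOp.target, Bool.false_xor]
    by_cases hj : T ≤ (j : ℕ) ∧ (j : ℕ) < T + n
    · -- an input cell
      obtain ⟨i₀, hi₀⟩ : ∃ i₀ : Fin n, j = inCell n T i₀ :=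
        ⟨⟨j - T, by omega⟩, Fin.ext (by simp; omega)⟩
      subst hi₀
      rw [hB_tgt]
      have hcell : PCfg.cells (M.pinit x) (((inCell n T i₀ : Fin _) : ℕ) - (T : ℤ)) = M.embed x[i₀] := by
        have : (((inCell n T i₀ : Fin _) : ℕ) : ℤ) - T = ((i₀ : ℕ) : ℤ) := by simp
        rw [this, cells_pinit_of_lt x (lt_of_lt_of_eq i₀.2 hn)]
        rfl
      rw [hcell]
      have hno : ¬ ∃ j' : Fin (Wd n T), ¬(T ≤ (j' : ℕ) ∧ (j' : ℕ) < T + n) ∧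
          (YW.cell (inCell n T i₀) τ : YW M n (Wd n T)) = YW.cell j' (default : M.Γ) := by
        rintro ⟨j', hj', e⟩
        simp only [YW.cell.injEq] at e
        exact hj' (e.1 ▸ hj)
      rw [decide_eq_false hno]
      simp [ClOp.guard]
    · -- a cell outside the input: blank
      rw [hB_off _ (fun i₀ τ' e => hj ?_)]
      · have hcell : PCfg.cells (M.pinit x) ((j : ℕ) - (T : ℤ)) = default := by
          rcases Nat.lt_or_ge (j : ℕ) T with hjT | hjT
          · obtain ⟨k, hk⟩ : ∃ k : ℕ, ((j : ℕ) : ℤ) - T = Int.negSucc k :=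
              ⟨T - j - 1, by rw [Int.negSucc_eq]; omega⟩
            rw [hk, cells_pinit_negSucc]
          · have hk : ((j : ℕ) : ℤ) - T = ((j - T : ℕ) : ℤ) := by omega
            rw [hk, cells_pinit_of_le x (by omega)]
        rw [hcell]
        by_cases hτ : (default : M.Γ) = τ
        · subst hτ
          have hex : ∃ j' : Fin (Wd n T), ¬(T ≤ (j' : ℕ) ∧ (j' : ℕ) < T + n) ∧
              (YW.cell j (default : M.Γ) : YW M n (Wd n T)) = YW.cell j' default := ⟨j, hj, rfl⟩
          rw [decide_eq_true hex]
          simp [ClOp.guard]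
        · have hnex : ¬ ∃ j' : Fin (Wd n T), ¬(T ≤ (j' : ℕ) ∧ (j' : ℕ) < T + n) ∧
              (YW.cell j τ : YW M n (Wd n T)) = YW.cell j' default := by
            rintro ⟨j', -, e⟩; simp only [YW.cell.injEq] at e; exact hτ e.2.symm
          rw [decide_eq_false hτ, decide_eq_false hnex]
          simp [ClOp.guard]
      · simp only [YW.cell.injEq] at e
        rw [e.1]; simp

end Init

/-! ### Output: the answer onto wire `0` -/

section Output

variable (M) in
/-- The wire that becomes wire `0` of the circuit: the first input wire, or — on the empty
input — the first wire of the state register. [folklore] -/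
def wire0 (n W : ℕ) : YW M n W :=
  if h : 0 < n then YW.inp ⟨0, h⟩
  else YW.st ((Fintype.equivFin M.Λ).symm ⟨0, Fintype.card_pos_iff.2 ⟨M.start⟩⟩)

/-- `wire0` is an input or a state wire. [folklore] -/
theorem wire0_ne_ans : wire0 M n W ≠ YW.ans := by unfold wire0; split_ifs <;> simp
/-- `wire0` is not a cell wire. [folklore] -/
theorem wire0_ne_cell (j : Fin W) (τ : M.Γ) : wire0 M n W ≠ YW.cell j τ := by
  unfold wire0; split_ifs <;> simp
/-- `wire0` is not a head wire. [folklore] -/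
theorem wire0_ne_head (j : Fin W) : wire0 M n W ≠ YW.head j := by unfold wire0; split_ifs <;> simp
/-- `wire0` is not a register wire. [folklore] -/
theorem wire0_ne_reg (τ : M.Γ) : wire0 M n W ≠ YW.reg τ := by unfold wire0; split_ifs <;> simp
/-- `wire0` is not the direction wire. [folklore] -/
theorem wire0_ne_dir : wire0 M n W ≠ YW.dir := by unfold wire0; split_ifs <;> simp

variable (M) in
/-- **Output.** Copy the acceptance bit (the wire of the accepting state) to the answer wire and
swap the answer wire with `wire0` (three `CNOT`s). [cite: NielsenChuang2010, §1.3.4 (swap from three CNOTs)] -/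
def outputOps (n W : ℕ) : List (ClOp (YW M n W)) :=
  [ClOp.cnot (YW.st M.accept) YW.ans,
    ClOp.cnot YW.ans (wire0 M n W), ClOp.cnot (wire0 M n W) YW.ans, ClOp.cnot YW.ans (wire0 M n W)]

/-- Well-formedness of `outputOps`. [folklore] -/
theorem wf_of_mem_outputOps {op : ClOp (YW M n W)} (hop : op ∈ outputOps M n W) : op.WF := by
  simp only [outputOps, List.mem_cons, List.not_mem_nil, or_false] at hop
  rcases hop with rfl | rfl | rfl | rfl
  · exact fun h => by simp at h
  · exact wire0_ne_ans.symm
  · exact wire0_ne_ans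
  · exact wire0_ne_ans.symm

/-- The final label: wire `0` holds the acceptance bit, the answer wire holds the former value of
wire `0`, everything else is the label of the configuration. [folklore] -/
def final {x : List Bool} {T : ℕ} (c : M.PCfg) (w : YW M x.length (Wd x.length T) → Bool) :
    YW M x.length (Wd x.length T) → Bool :=
  fun i => if i = wire0 M _ _ then decide (c.1.q = M.accept)
    else if i = YW.ans then w (wire0 M _ _) else w i

/-- **Semantics of `outputOps`** on a label with clear answer wire. [cite: NielsenChuang2010, §1.3.4 (swap from three CNOTs)] -/
theorem clEval_outputOps_enc (x : List Bool) (T : ℕ) (c : M.PCfg) :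
    clEval (outputOps M x.length (Wd x.length T)) (enc x T c) = final c (enc x T c) := by
  unfold outputOps
  rw [clEval_cons, ClOp.eval_cnot,
    show [ClOp.cnot YW.ans (wire0 M x.length (Wd x.length T)), ClOp.cnot (wire0 M _ _) YW.ans,
      ClOp.cnot YW.ans (wire0 M _ _)] = [ClOp.cnot YW.ans (wire0 M _ _), ClOp.cnot (wire0 M _ _) YW.ans,
      ClOp.cnot YW.ans (wire0 M _ _)] from rfl,
    RevMux.clEval_swap _ _ wire0_ne_ans.symm]
  funext i
  simp only [final]
  by_cases h0 : i = wire0 M _ _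
  · subst h0
    rw [if_pos rfl, update_self, if_pos rfl]
    simp [enc]
  · rw [if_neg h0, if_neg h0]
    by_cases ha : i = YW.ans
    · subst ha
      rw [if_pos rfl, if_pos rfl, update_of_ne wire0_ne_ans]
    · rw [if_neg ha, if_neg ha, update_of_ne ha]

/-- The final label read at `wire0` is the acceptance bit. [folklore] -/
theorem final_wire0 {x : List Bool} {T : ℕ} (c : M.PCfg)
    (w : YW M x.length (Wd x.length T) → Bool) : final c w (wire0 M _ _) = decide (c.1.q = M.accept) :=
  if_pos rfl

end Output

/-! ### Injectivity of the encoding on the window -/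

section Injective

variable {x : List Bool} {T : ℕ}

/-- **The encoding is injective on the configurations of the window**: a configuration with head
in `[-T, T]` and non-blank cells in `[-T, |x| + T)` is determined by its label. [cite: NishimuraOzawa2002, Thm. 4.3 (proof)] -/
theorem enc_injective_of_inWindow {c c' : M.PCfg} (hc : PCfg.InWindow x.length T c)
    (hc' : PCfg.InWindow x.length T c') (h : enc x T c = enc x T c') : c = c' := by
  have hq : c.1.q = c'.1.q := by
    have := congrFun h (YW.st c.1.q)
    simp only [enc, decide_true] at this
    exact (of_decide_eq_true this.symm).symm
  have hpos : c.2 = c'.2 := by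
    have := congrFun h (YW.head (headFin hc le_rfl))
    rw [enc_head hc le_rfl, enc_head_val hc' le_rfl] at this
    simp only [decide_true, headFin] at this
    have e := of_decide_eq_true this.symm
    have h1 := headIdx_cast hc le_rfl; have h2 := headIdx_cast hc' le_rfl
    omega
  refine hc.ext hc' hq hpos fun z hz₁ hz₂ => ?_
  obtain ⟨j, hj⟩ : ∃ j : Fin (Wd x.length T), ((j : ℕ) : ℤ) - T = z :=
    ⟨⟨(z + T).toNat, by show (z + T).toNat < 2 * T + x.length + 1; omega⟩, by simp; omega⟩
  have := congrFun h (YW.cell j (PCfg.cells c z))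
  simp only [enc, hj, decide_true] at this
  exact (of_decide_eq_true this.symm).symm

/-- The final labels of two configurations of the window coincide only if the configurations
do. [folklore] -/
theorem final_enc_injective_of_inWindow {c c' : M.PCfg} (hc : PCfg.InWindow x.length T c)
    (hc' : PCfg.InWindow x.length T c')
    (h : final c (enc x T c) = final c' (enc x T c')) : c = c' := by
  refine enc_injective_of_inWindow hc hc' (funext fun i => ?_)
  by_cases h0 : i = wire0 M _ _
  · subst h0
    have := congrFun h YW.ans
    simp only [final, if_neg (wire0_ne_ans (M := M)).symm, if_true] at this
    exact this
  · by_cases ha : i = YW.ans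
    · subst ha; rfl
    · have := congrFun h i
      simp only [final, if_neg h0, if_neg ha] at this
      exact this

end Injective

end YaoSim

end Literature.Computability.QuantumComplexity

end
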